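import Summits.FinalStateConjecture.FinalStateConjecture.Theorems.EIHFluxBalanceInertialRecessionPerforatedGauss
import Summits.FinalStateConjecture.FinalStateConjecture.Theorems.EIHFluxBalanceInertialRecessionStubPseudotensorBoundMatrix
import Mathlib.MeasureTheory.Constructions.HaarToSphere
import Mathlib.MeasureTheory.Measure.Lebesgue.VolumeOfBalls
import Mathlib.Analysis.SpecialFunctions.ImproperIntegrals

/-!
# Route EIHFluxBalance — `InertialRecession`, line `sublinear-is-free-clean-window-charges`:
# the bulk term of the perforated Gauss law (stub `stub_identification`, part A5a)

Helper file (`--supports stmt-FinalStateConjecture-10166`) for the crux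
`Summit.FinalStateConjecture.FinalStateConjecture.Theses.EIHFluxBalance.InertialRecession`.

In the identification the lab charge of a window sphere minus the charges of the small spheres about
the holes inside it is the bulk integral `∫_K Σ_α ∂_α h^{μ0α}` over the perforated ball `K`
(`LLGauss.perforatedGauss`). In vacuum the integrand is `(−g) t^{μ0}_LL`, bounded by
`C_PTB ‖∂g‖²` (the pseudotensor bound of the line), and on `K` the lab metric has
`‖∂g‖ ≤ K d^{-7/4}`, `d` the distance to the nearest hole (`lab_sphereConditions`). This file
turns that into the decay of the bulk:
* `integral_rpow_norm_sub_ge` — the radial integral `∫_{‖y−ξ‖ ≥ ρ₀} ‖y − ξ‖^{-7/2} dy = 8π/√ρ₀`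
  (`integral_fun_norm_addHaar`, `volume` of the unit ball of `E3`, `∫_{ρ₀}^∞ r^{-3/2}`);
* `abs_setIntegral_le_of_decay` — **if `|F| ≤ L (min_i ‖y − ξ_i‖)^{-7/2}` on a set all of whose
  points are at distance `≥ ρ₀` from every centre, then `|∫ F| ≤ L N 8π/√ρ₀`**;
* `abs_emComplex_le_of_pseudotensorBound` — the pointwise vacuum bound
  `|Σ_α ∂_α h^{μνα}(x)| ≤ C_PTB b²` from the pseudotensor bound, `Ric(g)(x) = 0`, `‖g(x) − η‖ ≤ 1/2`
  and `‖Dg(x)‖ ≤ b` (`LLBalance.emComplex_eq_neg_metricDet_mul`).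
[cite: LandauLifshitz1975, §96 (96.11), (96.17)]
-/

set_option linter.dupNamespace false

noncomputable section

-- instance search on the nested operator spaces `E4 →L[ℝ] E4 →L[ℝ] ℝ` is deep
set_option maxSynthPendingDepth 3

open Set Metric Filter MeasureTheory MeasureTheory.Measure Module
open scoped Topology ContDiff RealInnerProductSpace

namespace Summit.FinalStateConjecture.FinalStateConjecture.Theorems

namespace SublinearIsFree.ChargeModel

open Literature.Geometry.Lorentzian Literature.Geometry.Lorentzian.LandauLifshitz
open LLBalance SublinearIsFree.PseudotensorBound

/-! ### The radial integral `∫_{‖y‖ ≥ ρ₀} ‖y‖^{-7/2}` -/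

/-- `∫_{ρ₀}^∞ r² r^{-7/2} dr = 2 ρ₀^{-1/2}` (`ρ₀ > 0`), the radial part of the decay integral. [folklore] -/
theorem setIntegral_Ioi_sq_smul_indicator_rpow {ρ₀ : ℝ} (hρ₀ : 0 < ρ₀) :
    ∫ r in Ioi (0 : ℝ), r ^ (3 - 1) • (Ici ρ₀).indicator (fun r : ℝ ↦ r ^ (-(7 / 2) : ℝ)) r =
      2 * ρ₀ ^ (-(1 / 2) : ℝ) := by
  have hfun : ∀ r ∈ Ioi (0 : ℝ), r ^ (3 - 1) • (Ici ρ₀).indicator (fun r : ℝ ↦ r ^ (-(7 / 2) : ℝ)) r =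
      (Ici ρ₀).indicator (fun r : ℝ ↦ r ^ (-(3 / 2) : ℝ)) r := by
    intro r hr
    have hr0 : 0 < r := hr
    by_cases h : ρ₀ ≤ r
    · rw [indicator_of_mem (mem_Ici.2 h), indicator_of_mem (mem_Ici.2 h), smul_eq_mul,
        show ((3 : ℕ) - 1 : ℕ) = 2 from rfl, ← Real.rpow_natCast r 2, Nat.cast_ofNat, ← Real.rpow_add hr0]
      norm_num
    · rw [indicator_of_notMem (fun h' ↦ h (mem_Ici.1 h')), indicator_of_notMem (fun h' ↦ h (mem_Ici.1 h')),
        smul_zero]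
  rw [setIntegral_congr_fun measurableSet_Ioi hfun, setIntegral_indicator measurableSet_Ici,
    show Ioi (0 : ℝ) ∩ Ici ρ₀ = Ici ρ₀ from by
      ext r
      simp only [mem_inter_iff, mem_Ioi, mem_Ici]
      exact ⟨fun h ↦ h.2, fun h ↦ ⟨hρ₀.trans_le h, h⟩⟩,
    integral_Ici_eq_integral_Ioi, integral_Ioi_rpow_of_lt (by norm_num) hρ₀]
  rw [show (-(3 / 2) + 1 : ℝ) = -(1 / 2) by norm_num]
  ring

/-- **The decay integral**: `∫_{‖y−ξ‖ ≥ ρ₀} ‖y − ξ‖^{-7/2} dy = 8π ρ₀^{-1/2}` on `E3` (`ρ₀ > 0`),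
written with the radial indicator profile (polar coordinates, `integral_fun_norm_addHaar`).
[folklore] -/
theorem integral_indicator_rpow_norm_sub {ρ₀ : ℝ} (hρ₀ : 0 < ρ₀) (ξ : E3) :
    ∫ y : E3, (Ici ρ₀).indicator (fun r : ℝ ↦ r ^ (-(7 / 2) : ℝ)) ‖y - ξ‖ = 8 * Real.pi * ρ₀ ^ (-(1 / 2) : ℝ) := by
  rw [integral_sub_right_eq_self (fun y : E3 ↦ (Ici ρ₀).indicator (fun r : ℝ ↦ r ^ (-(7 / 2) : ℝ)) ‖y‖) ξ,
    integral_fun_norm_addHaar (μ := (volume : Measure E3))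
      (f := (Ici ρ₀).indicator fun r : ℝ ↦ r ^ (-(7 / 2) : ℝ)),
    finrank_euclideanSpace_fin, setIntegral_Ioi_sq_smul_indicator_rpow hρ₀, Measure.real,
    EuclideanSpace.volume_ball_fin_three, ENNReal.toReal_mul, ← ENNReal.ofReal_pow zero_le_one,
    one_pow, ENNReal.toReal_ofReal zero_le_one, ENNReal.toReal_ofReal (by positivity)]
  simp only [nsmul_eq_mul, smul_eq_mul, Nat.cast_ofNat]
  ring

/-- The decay kernel is integrable (its integral is finite and it is nonnegative and measurable:
through the radial integrability criterion `integrable_fun_norm_addHaar`). [folklore] -/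
theorem integrable_indicator_rpow_norm_sub {ρ₀ : ℝ} (hρ₀ : 0 < ρ₀) (ξ : E3) :
    Integrable (fun y : E3 ↦ (Ici ρ₀).indicator (fun r : ℝ ↦ r ^ (-(7 / 2) : ℝ)) ‖y - ξ‖) := by
  have h0 : Integrable (fun y : E3 ↦ (Ici ρ₀).indicator (fun r : ℝ ↦ r ^ (-(7 / 2) : ℝ)) ‖y‖) := by
    rw [integrable_fun_norm_addHaar (μ := (volume : Measure E3))
      (f := (Ici ρ₀).indicator fun r : ℝ ↦ r ^ (-(7 / 2) : ℝ)), finrank_euclideanSpace_fin]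
    have hfun : ∀ r ∈ Ioi (0 : ℝ), r ^ (3 - 1) • (Ici ρ₀).indicator (fun r : ℝ ↦ r ^ (-(7 / 2) : ℝ)) r =
        (Ici ρ₀).indicator (fun r : ℝ ↦ r ^ (-(3 / 2) : ℝ)) r := by
      intro r hr
      have hr0 : 0 < r := hr
      by_cases h : ρ₀ ≤ r
      · rw [indicator_of_mem (mem_Ici.2 h), indicator_of_mem (mem_Ici.2 h), smul_eq_mul,
          show ((3 : ℕ) - 1 : ℕ) = 2 from rfl, ← Real.rpow_natCast r 2, Nat.cast_ofNat, ← Real.rpow_add hr0]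
        norm_num
      · rw [indicator_of_notMem (fun h' ↦ h (mem_Ici.1 h')), indicator_of_notMem (fun h' ↦ h (mem_Ici.1 h')),
          smul_zero]
    have hint : IntegrableOn ((Ici ρ₀).indicator fun r : ℝ ↦ r ^ (-(3 / 2) : ℝ)) (Ioi (0 : ℝ)) := by
      rw [integrableOn_indicator_iff measurableSet_Ici,
        show Ici ρ₀ ∩ Ioi (0 : ℝ) = Ici ρ₀ from by
          ext r
          simp only [mem_inter_iff, mem_Ioi, mem_Ici]
          exact ⟨fun h ↦ h.1, fun h ↦ ⟨h, hρ₀.trans_le h⟩⟩,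
        integrableOn_Ici_iff_integrableOn_Ioi]
      exact integrableOn_Ioi_rpow_of_lt (by norm_num) hρ₀
    exact hint.congr_fun (fun r hr ↦ (hfun r hr).symm) measurableSet_Ioi
  exact h0.comp_sub_right ξ

/-! ### The bulk bound -/

/-- On a set whose points are at distance `≥ ρ₀` from a centre, the decay kernel is the plain power.
[folklore] -/
theorem indicator_rpow_norm_sub_eq {ρ₀ : ℝ} {ξ y : E3} (h : ρ₀ ≤ ‖y - ξ‖) :
    (Ici ρ₀).indicator (fun r : ℝ ↦ r ^ (-(7 / 2) : ℝ)) ‖y - ξ‖ = ‖y - ξ‖ ^ (-(7 / 2) : ℝ) :=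
  indicator_of_mem (mem_Ici.2 h) _

/-- **The nearest-hole power is dominated by the sum over the holes**:
`(min_i ‖y − ξ_i‖)^{-7/2} ≤ Σ_i ‖y − ξ_i‖^{-7/2}` (`N ≥ 1`; the infimum is attained). [folklore] -/
theorem rpow_iInf_norm_sub_le_sum {N : ℕ} (hN : 0 < N) (ξ : Fin N → E3) (y : E3) :
    (⨅ i, ‖y - ξ i‖) ^ (-(7 / 2) : ℝ) ≤ ∑ i, ‖y - ξ i‖ ^ (-(7 / 2) : ℝ) := by
  haveI : Nonempty (Fin N) := ⟨⟨0, hN⟩⟩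
  obtain ⟨i₀, hi₀⟩ := exists_eq_ciInf_of_finite (f := fun i ↦ ‖y - ξ i‖)
  rw [← hi₀]
  exact Finset.single_le_sum (f := fun i ↦ ‖y - ξ i‖ ^ (-(7 / 2) : ℝ))
    (fun i _ ↦ Real.rpow_nonneg (norm_nonneg _) _) (Finset.mem_univ i₀)

/-- **The bulk bound.** If `|F| ≤ L Σ_i ‖y − ξ_i‖^{-7/2}` on a measurable set `A ⊆ E3` all of whose
points are at distance `≥ ρ₀ > 0` from every centre `ξ_i`, then `|∫_A F| ≤ L N 8π ρ₀^{-1/2}`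
(no integrability of `F` is needed: a non-integrable `F` has integral `0`). [folklore] -/
theorem abs_setIntegral_le_of_decay {N : ℕ} (ξ : Fin N → E3) {ρ₀ L : ℝ} (hρ₀ : 0 < ρ₀) (hL : 0 ≤ L)
    {A : Set E3} (hA : MeasurableSet A) {F : E3 → ℝ} (hfar : ∀ y ∈ A, ∀ i, ρ₀ ≤ ‖y - ξ i‖)
    (hF : ∀ y ∈ A, |F y| ≤ L * ∑ i, ‖y - ξ i‖ ^ (-(7 / 2) : ℝ)) :
    |∫ y in A, F y| ≤ L * N * (8 * Real.pi * ρ₀ ^ (-(1 / 2) : ℝ)) := by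
  set G : E3 → ℝ := fun y ↦ L * ∑ i, (Ici ρ₀).indicator (fun r : ℝ ↦ r ^ (-(7 / 2) : ℝ)) ‖y - ξ i‖ with hG
  have hGi : Integrable G := (integrable_finsetSum _ fun i _ ↦
    integrable_indicator_rpow_norm_sub hρ₀ (ξ i)).const_mul L
  have hG0 : ∀ y, 0 ≤ G y := fun y ↦ mul_nonneg hL (Finset.sum_nonneg fun i _ ↦ by
    rw [indicator_apply]
    split_ifs
    · exact Real.rpow_nonneg (norm_nonneg _) _
    · exact le_rfl)
  have hGA : ∀ y ∈ A, G y = L * ∑ i, ‖y - ξ i‖ ^ (-(7 / 2) : ℝ) := fun y hy ↦ by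
    simp only [hG, indicator_rpow_norm_sub_eq (hfar y hy _)]
  calc |∫ y in A, F y| ≤ ∫ y in A, |F y| := abs_integral_le_integral_abs
    _ ≤ ∫ y in A, G y := by
        refine integral_mono_of_nonneg (ae_of_all _ fun y ↦ abs_nonneg _) hGi.integrableOn ?_
        rw [EventuallyLE, ae_restrict_iff' hA]
        exact ae_of_all _ fun y hy ↦ (hF y hy).trans (le_of_eq (hGA y hy).symm)
    _ ≤ ∫ y, G y := setIntegral_le_integral hGi (ae_of_all _ hG0)
    _ = L * N * (8 * Real.pi * ρ₀ ^ (-(1 / 2) : ℝ)) := by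
        rw [hG, integral_const_mul, integral_finsetSum _ fun i _ ↦
          integrable_indicator_rpow_norm_sub hρ₀ (ξ i)]
        simp only [integral_indicator_rpow_norm_sub hρ₀, Finset.sum_const, Finset.card_univ,
          Fintype.card_fin, nsmul_eq_mul]
        ring

/-! ### The pointwise vacuum bound of the Landau–Lifshitz complex -/

/-- **`|Σ_α ∂_α h^{μνα}(x)| ≤ C_PTB b²` in vacuum.** Given the pseudotensor bound of the line with
constant `C` (the hypothesis `hPTB`), at a point where `g` is `C²`, symmetric nearby, within `1/2` of
`η`, with `‖Dg(x)‖ ≤ b` and `Ric(g)(x) = 0`: `Σ_α ∂_α h^{μνα} = (−g)((8π)⁻¹ G^{μν} + t^{μν})` with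
`G = 0`. [cite: LandauLifshitz1975, §96 (96.7), (96.11)] -/
theorem abs_emComplex_le_of_pseudotensorBound {C : ℝ}
    (hPTB : ∀ (g : E4 → E4 →L[ℝ] E4 →L[ℝ] ℝ) (x : E4) (b : ℝ), ContDiffAt ℝ 2 g x →
      (∀ᶠ y in 𝓝 x, ∀ v w : E4, g y v w = g y w v) → ‖g x - Minkowski.bilin‖ ≤ 1 / 2 →
      (∀ v : E4, ‖fderiv ℝ g x v‖ ≤ b * ‖v‖) →
      ∀ μ ν : Fin 4, |metricDet g x * pseudotensor g x μ ν| ≤ C * b ^ 2)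
    {g : E4 → E4 →L[ℝ] E4 →L[ℝ] ℝ} {x : E4} {b : ℝ} (hg : ContDiffAt ℝ 2 g x)
    (hsym : ∀ᶠ y in 𝓝 x, ∀ v w : E4, g y v w = g y w v) (hη : ‖g x - Minkowski.bilin‖ ≤ 1 / 2)
    (hb : ∀ v : E4, ‖fderiv ℝ g x v‖ ≤ b * ‖v‖) (hric : MetricCoord.ricAt g x = 0) (μ ν : Fin 4) :
    |emComplex g x μ ν| ≤ C * b ^ 2 := by
  have hdet : metricDet g x ≠ 0 := metricDet_ne_zero hη
  rw [emComplex_eq_neg_metricDet_mul hdet, einsteinUpper_eq_zero_of_ricAt_eq_zero hric, mul_zero,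
    zero_add, neg_mul, abs_neg]
  exact hPTB g x b hg hsym hη hb μ ν

end SublinearIsFree.ChargeModel

/-- Registered sub-goal form (stub `ll_bulk_decay_bound` of the crux item) of
`SublinearIsFree.ChargeModel.abs_setIntegral_le_of_decay`: the bulk integral of a density decaying like
the `−7/2` power of the distance to the nearest of `N` centres, outside balls of radius `ρ₀` about them,
is `O(N ρ₀^{-1/2})`. [folklore] -/
theorem ll_bulk_decay_bound : ∀ {N : ℕ} (ξ : Fin N → EuclideanSpace ℝ (Fin 3)) {ρ₀ L : ℝ}, 0 < ρ₀ → 0 ≤ L → ∀ {A : Set (EuclideanSpace ℝ (Fin 3))}, MeasurableSet A → ∀ {F : EuclideanSpace ℝ (Fin 3) → ℝ}, (∀ y ∈ A, ∀ i, ρ₀ ≤ ‖y - ξ i‖) → (∀ y ∈ A, |F y| ≤ L * ∑ i, ‖y - ξ i‖ ^ (-(7 / 2) : ℝ)) → |∫ y in A, F y| ≤ L * N * (8 * Real.pi * ρ₀ ^ (-(1 / 2) : ℝ)) :=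
  fun ξ _ρ₀ _L hρ₀ hL _A hA _F hfar hF ↦
    SublinearIsFree.ChargeModel.abs_setIntegral_le_of_decay ξ hρ₀ hL hA hfar hF

end Summit.FinalStateConjecture.FinalStateConjecture.Theorems

end
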